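import Literature.Probability.LatticeModels.FKIsingCylinderIdentityMoments
import Literature.Probability.LatticeModels.FKIsingInterfaceSLEFrontier
import Literature.Probability.RandomPlanarGeometry.DrivingProcessWeakLimitVarying
import Literature.Probability.RandomPlanarGeometry.ObservableClockPassage
import HarnessLib

/-!
# FK-Ising interfaces and SLE_{16/3}: the lattice-data form of the observable martingale fact (L‴)

Topic `Literature/Probability/LatticeModels` (family `crit-ising`); theorems only (no definition,
no named fact). A step of the decomposition of **crit-ising.S17**, FK half —
Chelkak–Duminil-Copin–Hongler–Kemppainen–Smirnov, C. R. Math. 352 (2014), Thm. 2: the critical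
FK-Ising Dobrushin interfaces converge in law to chordal SLE_{16/3} — whose named-fact frontier in
the tree is `fkIsing_rsw` (Duminil-Copin–Smirnov 2012, Thm. 3.16) and the layer-4 fact **(L‴)**
`exists_observableMartingale_fkInterface` (`FKIsingObservableMartingale.lean`;
`convergesInLawToSLE_sixteen_thirds_fkInterface_of_fkIsing_rsw_of_observableMartingale`,
`FKIsingInterfaceSLEFrontier.lean`).

(L‴) is already a theorem of the tree *relative to abstract limit data*
(`exists_observableMartingale_fkInterface_of_limitData₀`, `FKIsingCylinderIdentityMoments.lean`):
for every subsequential limit law `μ` and chordal uniformizing map `φ` it asks for (J₀) — `μ`-a.e.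
describability through `φ` and convergence in distribution, on SOME probability spaces
`(Ω'_k, P_k)`, of continuous processes `V^k` to the driving function under `μ` — and for (D) —
discrete martingales `F^k` on the same spaces approximating the FK observable `N^y(V^k)` at
capacity levels. The present file **instantiates those data on the lattice**, in the shape in
which the printed proof produces them (CDHKS 2014, §3, first lines and Thm. 3: "consider a
family of conformal maps `φ^δ` from `Ω^δ` onto `ℍ` … `φ^δ → φ` … `γ^δ ↦ w^δ`", the driving process
of the discrete interface read through the discrete uniformizing map; Duminil-Copin–Smirnov 2012,
proof of Prop. 6.7, p. 29: the martingales are the slit-domain observables at the lattice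
capacity times), by composing three theorems of the tree:

* Kemppainen–Smirnov's Thm. 1.5 (ii)–(iii) with Cor. 1.7–1.8 for curve laws in approximating
  domains, from box tightness and the convergence of the uniformizing maps
  (`ae_isLoewnerDescribable_and_tendstoInDistribution_drivingPath_varying`,
  `RandomPlanarGeometry/DrivingProcessWeakLimitVarying.lean`), applied to the laws
  `μs k = (fkDobrushinMeasure (E δ_k)).map (fkInterfaceCurve D (E δ_k))` of the interfaces along
  a realising sequence of positive admissible meshes of the subsequential limit
  (`exists_seq_admissible_of_isSubseqLimitLaw`);
* the transport of convergence in distribution back to the lattice probability spaces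
  `(BondConfig ℤ², fkDobrushinMeasure (E δ_k))` (`tendstoInDistribution_comp_of_map_eq`:
  convergence in distribution is a property of the laws), so that (J₀) holds with
  `Ω'_k = BondConfig ℤ²` and `V^k = drivingFunction (φs k) ∘ fkInterfaceCurve D (E δ_k)`;
* the packaging of (D) from capacity clocks and Doob martingales at every scale
  (`Loewner.exists_discreteMartingaleData_of_clocks_bound`, `RandomPlanarGeometry/ObservableClockPassage.lean`,
  v4: the bound on the stopped martingales is the hypothesis `‖c_k E[X_k | 𝒢_n]‖ ≤ C`, not
  `‖X_k‖ ≤ 1 ∧ ‖c_k‖ ≤ C`, since `c_k ≍ δ_k^{-1/2}`).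

The result, `exists_observableMartingale_fkInterface_of_latticeData` (and, given `fkIsing_rsw`,
`convergesInLawToSLE_sixteen_thirds_fkInterface_of_fkIsing_rsw_of_latticeData`), has ONE
hypothesis, quantified over the Dobrushin domain `(D; a, b)`, the discretisation `E`, the chordal
map `φ` and an arbitrary sequence of positive admissible meshes `δ_k → 0`, asking for discrete
Dobrushin domains `(D_k; a_k, b_k)` with chordal uniformizing maps `φ_k` such that

1. (domains) the boundary extensions converge, `Φ_k → Φ` uniformly on the compacts
   `{0 ≤ im} ∩ closedBall 0 R` and uniformly at infinity, and `b_k → b` — the hypotheses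
   `hU1`, `hU2`, `hb` of the Kemppainen–Smirnov theorem above (CDHKS §3: "`φ^δ → φ`");
2. (box tightness) for every `ε > 0` a Kemppainen–Smirnov box of Loewner pairs (moduli of the
   capacity-parametrised pull-back and of its driving term, transience profile) carrying
   `fkDobrushinMeasure`-mass `≥ 1 - ε` of the interfaces read through `φ_k`, at every scale —
   KS Prop. 3.2 with Thm. 3.9–3.10 for the family, i.e. the output of Condition G2 (for the
   FK-Ising interfaces: CDHKS Thm. 4); stated on the lattice side with preimages and converted
   to the laws through the closedness of the images of the boxes
   (`isClosed_image_and_continuousOn_drivingPath`);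
3. (clocks and slit observables) for every `y > 0` and levels `s < t < T(iy)`: at every scale a
   filtration of `BondConfig ℤ²`, an adapted clock `θ^k` with small start and increments reaching
   `t` off a small bad event, locality of `V^k` with respect to it, a variable `X_k` and a
   normalisation `c_k` with `‖c_k E[X_k | 𝒢_n]‖ ≤ C` for `n ≤ M_k` (on the lattice
   `c_k ≍ δ_k^{-1/2}` is Smirnov's normalisation and this is the boundedness of the renormalised
   slit-domain observables at a bulk point; `ObservableClockPassage.lean`, v4), and the
   approximation `‖c_k E[X_k | 𝒢_n] - N^y_{θ^k_n}(V^k)‖ ≤ ε_k → 0` — Duminil-Copin–Smirnov's Lemma 6.6 (in the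
   tree: `martingale_slitExpectation`, `condExp_explorationFiltration_ae_eq_slitExpectation` of
   `FKExplorationDomainMarkov.lean`, with the adapters of `FKExplorationClock.lean` and
   `FKInterfaceDrivingLocality.lean`) together with Smirnov's theorem (Ann. Math. 172 (2010),
   Thm. 2.2 = DCS Thm. 3.15) over the slit domains.

Items 1–3 are the inputs of the printed proof that the tree does not yet have as theorems for
the FK-Ising interfaces (the lattice half of KS Thm. 1.5 / Cor. 1.7–1.8 through Condition G2,
and Smirnov's observable convergence uniformly over the slit domains); everything downstream of
them is proved, here and in the files cited.

## References

* D. Chelkak, H. Duminil-Copin, C. Hongler, A. Kemppainen, S. Smirnov, *Convergence of Ising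
  interfaces to Schramm's SLE curves*, C. R. Math. Acad. Sci. Paris 352 (2014) 157–161
  (arXiv:1312.0533): Thm. 2, Thm. 3, Thm. 4, §3. [CDHKSCRAS2014]
* A. Kemppainen, S. Smirnov, *Random curves, scaling limits and Loewner evolutions*, Ann. Probab.
  45 (2017) 698–779 (arXiv:1212.6215): Thm. 1.5, Cor. 1.7, Cor. 1.8, Prop. 3.2, §3.5.
  [KemppainenSmirnov2017]
* H. Duminil-Copin, S. Smirnov, *Conformal invariance of lattice models*, Clay Math. Proc. 15
  (2012) 213–276 (arXiv:1109.1549): Thm. 3.15, Thm. 3.16, Lemma 6.6, Prop. 6.7 (proof, p. 29).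
  [DuminilCopinSmirnov2012Clay]
* S. Smirnov, *Conformal invariance in random cluster models. I*, Ann. of Math. 172 (2010)
  1435–1467: Thm. 2.2. [Smirnov2010]
-/

noncomputable section

open MeasureTheory ProbabilityTheory Filter Topology Set Metric
open UpperHalfPlane (upperHalfPlaneSet)
open scoped NNReal ENNReal BoundedContinuousFunction
open Literature.Probability.RandomPlanarGeometry Literature.Probability.LatticeModels
  Literature.Probability.Percolation

namespace Literature.Probability.LatticeModels

open RandomPlanarGeometry.Loewner
open scoped Literature.Probability.RandomPlanarGeometry.PathBorel

/-! ### Convergence in distribution through a change of sample space -/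

/-- **Convergence in distribution is a property of the laws.** If `X_i → Z` in distribution, the
`X_i : Ω_i → E` living on `(Ω_i, μ_i)`, and `Y_i : Ω₀_i → Ω_i` are a.e.-measurable maps with
`(P_i).map Y_i = μ_i`, then `X_i ∘ Y_i → Z` in distribution on `(Ω₀_i, P_i)`: the laws agree
(`AEMeasurable.map_map_of_aemeasurable`). [folklore] -/
theorem tendstoInDistribution_comp_of_map_eq {ι E : Type*} {Ω Ω₀ : ι → Type*}
    {m : ∀ i, MeasurableSpace (Ω i)} {m₀ : ∀ i, MeasurableSpace (Ω₀ i)}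
    {μ : ∀ i, Measure (Ω i)} [∀ i, IsProbabilityMeasure (μ i)]
    {P : ∀ i, Measure (Ω₀ i)} [∀ i, IsProbabilityMeasure (P i)]
    {Ω' : Type*} {m' : MeasurableSpace Ω'} {μ' : Measure Ω'} [IsProbabilityMeasure μ']
    [TopologicalSpace E] [MeasurableSpace E] [OpensMeasurableSpace E]
    {X : ∀ i, Ω i → E} {Z : Ω' → E} {l : Filter ι}
    (h : TendstoInDistribution X l Z μ μ') (Y : ∀ i, Ω₀ i → Ω i)
    (hY : ∀ i, AEMeasurable (Y i) (P i)) (hmap : ∀ i, (P i).map (Y i) = μ i) :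
    TendstoInDistribution (fun i ω ↦ X i (Y i ω)) l Z P μ' := by
  have hX : ∀ i, AEMeasurable (X i) ((P i).map (Y i)) := fun i ↦ by
    rw [hmap i]
    exact h.forall_aemeasurable i
  have hXY : ∀ i, AEMeasurable (fun ω ↦ X i (Y i ω)) (P i) := fun i ↦
    (hX i).comp_aemeasurable (hY i)
  refine ⟨hXY, h.aemeasurable_limit, ?_⟩
  have key : (fun i ↦ (⟨(P i).map (fun ω ↦ X i (Y i ω)),
      Measure.isProbabilityMeasure_map (hXY i)⟩ : ProbabilityMeasure E)) =
      fun i ↦ ⟨(μ i).map (X i), Measure.isProbabilityMeasure_map (h.forall_aemeasurable i)⟩ := by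
    funext i
    apply Subtype.ext
    change (P i).map (fun ω ↦ X i (Y i ω)) = (μ i).map (X i)
    rw [← hmap i, AEMeasurable.map_map_of_aemeasurable (hX i) (hY i)]
    rfl
  rw [key]
  exact h.tendsto

/-! ### Realising sequences of a subsequential limit law -/

/-- A subsequential limit law of the critical FK-Ising interfaces of an `IsDiscretisation` family
is realised along a sequence of **positive, admissible** meshes `δ_k → 0`: drop finitely many
terms of any realising sequence (`IsDiscretisation.eventually_isZdAdmissible`). [folklore] -/
theorem exists_seq_admissible_of_isSubseqLimitLaw {D : DobrushinDomain} {E : ℝ → DiscreteDobrushin}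
    (hE : IsDiscretisation D E) {μ : Measure (CurveClass ℂ)}
    (hlim : IsSubseqLimitLaw (Ωδ := fun _ ↦ BondConfig (Site 2))
      (fun δ ↦ fkInterfaceCurve D (E δ)) (fun δ ↦ fkDobrushinMeasure (E δ)) μ) :
    ∃ δs : ℕ → ℝ, (∀ k, 0 < δs k) ∧ Tendsto δs atTop (𝓝 0) ∧
      (∀ k, (E (δs k)).IsZdAdmissible) ∧
      ∀ f : CurveClass ℂ →ᵇ ℝ, Tendsto (fun k ↦ ∫ ω, f (fkInterfaceCurve D (E (δs k)) ω)
        ∂fkDobrushinMeasure (E (δs k))) atTop (𝓝 (∫ c, f c ∂μ)) := by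
  obtain ⟨s, hs, hconv⟩ := hlim
  have hpos : ∀ᶠ n in atTop, s n ∈ Ioi (0 : ℝ) := hs.eventually eventually_mem_nhdsWithin
  have hadm : ∀ᶠ n in atTop, (E (s n)).IsZdAdmissible :=
    hs.eventually hE.eventually_isZdAdmissible
  obtain ⟨k₀, hk₀⟩ := (hpos.and hadm).exists_forall_of_atTop
  refine ⟨fun k ↦ s (k + k₀), fun k ↦ (hk₀ _ (Nat.le_add_left _ _)).1, ?_,
    fun k ↦ (hk₀ _ (Nat.le_add_left _ _)).2, fun f ↦ (hconv f).comp (tendsto_add_atTop_nat k₀)⟩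
  exact (tendsto_nhds_of_tendsto_nhdsWithin hs).comp (tendsto_add_atTop_nat k₀)

/-! ### The assembly -/

/-- **(L‴) from the lattice data: Kemppainen–Smirnov in approximating domains, transported
to the lattice, and the clock packaging of the slit-domain martingales.** Suppose that for every
Dobrushin domain `(D; a, b)`, `IsDiscretisation` family `E`, chordal uniformizing map `φ` of `D`
and sequence of positive admissible meshes `δ_k → 0` there are discrete Dobrushin domains
`(D_k; a_k, b_k)` with chordal uniformizing maps `φ_k` such that: (1) the boundary extensions
`Φ_k → Φ` converge uniformly on `{0 ≤ im} ∩ closedBall 0 R` for every `R` and uniformly at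
infinity, and `b_k → b`; (2) for every `ε > 0` some Kemppainen–Smirnov box of Loewner pairs
(moduli `δγ, δW > 0`, transience profile `T`) has, at every scale `k`, `fkDobrushinMeasure`-mass
`≥ 1 - ε` of interfaces whose class is `⟦Φ_k ∘ γ̂⟧` for a pair `(γ̂, W)` of the box; (3) for every
`y > 0` and `s < t < T(iy) = cdhksTime y` there are `C` and `ε_k, Δ_k, η_k → 0` and, at every scale,
a filtration `𝒢` of `BondConfig ℤ²`, an adapted clock `θ`, a step bound `M`, a variable `X` and
a constant `c` with `‖c E[X | 𝒢_n]‖ ≤ C` a.s. for `n ≤ M`, and a measurable event `bad` of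
probability `≤ η_k`, with
`V^k = drivingFunction φ_k ∘ fkInterfaceCurve D (E δ_k)` revealed by step `M` and local for
`(𝒢, θ)`, and, off `bad`, `θ_0 ≤ Δ_k`, increments `≤ Δ_k`, level `t` reached by step `M`, and
`‖c E[X | 𝒢_n] - N^y_{θ_n}(V^k)‖ ≤ ε_k` whenever `n ≤ M`, `θ_n ≤ t + Δ_k`. THEN the layer-4 fact
(L‴) `exists_observableMartingale_fkInterface` holds. PROVED: along a realising sequence of
positive admissible meshes of the subsequential limit (`exists_seq_admissible_of_isSubseqLimitLaw`)
the interface laws converge weakly to `μ` (`integral_map`); (2) is box tightness of these laws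
(`Measure.map_apply_of_aemeasurable`, the images of the boxes being closed,
`isClosed_image_and_continuousOn_drivingPath` with `isCompact_pairBox`); Kemppainen–Smirnov's
theorem in approximating domains
(`ae_isLoewnerDescribable_and_tendstoInDistribution_drivingPath_varying`) gives describability
`μ`-a.e. and convergence in distribution of the discrete driving paths, transported to the lattice
spaces by `tendstoInDistribution_comp_of_map_eq`; (3) feeds
`Loewner.exists_discreteMartingaleData_of_clocks_bound`; and
`exists_observableMartingale_fkInterface_of_limitData₀` concludes. (CDHKS 2014, §3 and Thm. 3:
"`γ^δ ↦ w^δ`", "`φ^δ → φ`"; KS 2017, Thm. 1.5, Cor. 1.7–1.8; DCS 2012, Lemma 6.6, Thm. 3.15 and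
proof of Prop. 6.7.) [cite: CDHKSCRAS2014, Thm. 3 and §3] [cite: KemppainenSmirnov2017, Thm. 1.5, Cor. 1.7, Cor. 1.8] [cite: DuminilCopinSmirnov2012Clay, Lemma 6.6, Thm. 3.15 and Prop. 6.7 (proof, p. 29)] -/
theorem exists_observableMartingale_fkInterface_of_latticeData
    (h : ∀ (D : DobrushinDomain) (E : ℝ → DiscreteDobrushin), IsDiscretisation D E →
      ∀ φ : ConformalEquiv upperHalfPlaneSet D.carrier, D.IsChordalUniformizing φ →
      ∀ δs : ℕ → ℝ, (∀ k, 0 < δs k) → Tendsto δs atTop (𝓝 0) →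
        (∀ k, (E (δs k)).IsZdAdmissible) →
      ∃ (Ds : ℕ → DobrushinDomain) (φs : ∀ k, ConformalEquiv upperHalfPlaneSet (Ds k).carrier),
        (∀ k, (Ds k).IsChordalUniformizing (φs k)) ∧
        (∀ R : ℝ, TendstoUniformlyOn (fun k ↦ (φs k).boundaryExtension) φ.boundaryExtension
          atTop ({z : ℂ | 0 ≤ z.im} ∩ closedBall 0 R)) ∧
        (∀ ε : ℝ, 0 < ε → ∃ r : ℝ, ∀ᶠ k in atTop, ∀ z : ℂ, z ∈ {z : ℂ | 0 ≤ z.im} → r ≤ ‖z‖ →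
          dist ((φs k).boundaryExtension z) ((Ds k).pt 1) ≤ ε) ∧
        Tendsto (fun k ↦ (Ds k).pt 1) atTop (𝓝 (D.pt 1)) ∧
        (∀ ε : ℝ≥0∞, 0 < ε → ∃ (δγ δW : ℕ → ℝ) (T : ℕ → ℝ≥0), (∀ j, 0 < δγ j) ∧
          (∀ j, 0 < δW j) ∧
          ∀ k, fkDobrushinMeasure (E (δs k)) ((fkInterfaceCurve D (E (δs k))) ⁻¹'
            ((fun p ↦ compactifiedClass (φs k).boundaryExtension ((Ds k).pt 1) p.1) ''
              {p : C(ℝ≥0, ℂ) × C(ℝ≥0, ℝ) | p ∈ generatedPairs ∧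
                p.1 ∈ Process.modulusSet ({0} : Set ℂ) δγ ∧
                p.2 ∈ Process.modulusSet ({0} : Set ℝ) δW ∧
                ∀ (j : ℕ) (t : ℝ≥0), T j ≤ t → (j : ℝ) ≤ ‖p.1 t‖})ᶜ) ≤ ε) ∧
        (∀ y : ℝ, 0 < y → ∀ s t : ℝ≥0, s < t → t < cdhksTime y →
          ∃ (C : ℝ) (ε Δ η : ℕ → ℝ≥0), Tendsto ε atTop (𝓝 0) ∧ Tendsto Δ atTop (𝓝 0) ∧
            Tendsto η atTop (𝓝 0) ∧
            ∀ k, ∃ (𝒢 : Filtration ℕ (Set.instMeasurableSpace :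
                MeasurableSpace (BondConfig (Site 2))))
              (θ : ℕ → BondConfig (Site 2) → ℝ≥0) (M : ℕ) (X : BondConfig (Site 2) → ℂ) (c : ℂ)
              (bad : Set (BondConfig (Site 2))),
              Adapted 𝒢 θ ∧ (∀ ω, ω ∉ bad → θ 0 ω ≤ Δ k) ∧
              (∀ u, Measurable[𝒢 M] fun ω ↦
                drivingFunction (φs k) (fkInterfaceCurve D (E (δs k)) ω) u) ∧
              (∀ n u, Measurable[𝒢 n] ({ω | u ≤ θ n ω}.indicator fun ω ↦
                drivingFunction (φs k) (fkInterfaceCurve D (E (δs k)) ω) u)) ∧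
              (∀ᵐ ω ∂fkDobrushinMeasure (E (δs k)), ∀ n, n ≤ M →
                ‖c * (fkDobrushinMeasure (E (δs k)))[X|𝒢 n] ω‖ ≤ C) ∧
              MeasurableSet bad ∧ fkDobrushinMeasure (E (δs k)) bad ≤ η k ∧
              (∀ ω, ω ∉ bad → ∃ n ≤ M, t ≤ θ n ω) ∧
              (∀ ω, ω ∉ bad → ∀ n, n < M → θ (n + 1) ω ≤ θ n ω + Δ k) ∧
              (∀ᵐ ω ∂fkDobrushinMeasure (E (δs k)), ω ∉ bad → ∀ n, n ≤ M → θ n ω ≤ t + Δ k →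
                ‖c * (fkDobrushinMeasure (E (δs k)))[X|𝒢 n] ω -
                  observableProcess (fun u ω ↦ drivingFunction (φs k)
                    (fkInterfaceCurve D (E (δs k)) ω) u) y (θ n ω) ω‖ ≤ ε k))) :
    exists_observableMartingale_fkInterface := by
  refine exists_observableMartingale_fkInterface_of_limitData₀ fun D E hE μ hμ hlim φ hφ ↦ ?_
  haveI := hμ
  -- a realising sequence of positive admissible meshes
  obtain ⟨δs, hδpos, hδ0, hδadm, hconv⟩ := exists_seq_admissible_of_isSubseqLimitLaw hE hlim
  obtain ⟨Ds, φs, hφs, hU1, hU2, hb, hbox, hclock⟩ := h D E hE φ hφ δs hδpos hδ0 hδadm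
  -- the interface laws
  set Y : ∀ k : ℕ, BondConfig (Site 2) → CurveClass ℂ := fun k ↦ fkInterfaceCurve D (E (δs k))
    with hYdef
  set P : ∀ k : ℕ, Measure (BondConfig (Site 2)) := fun k ↦ fkDobrushinMeasure (E (δs k))
    with hPdef
  have hYm : ∀ k, AEMeasurable (Y k) (P k) := fun k ↦ aemeasurable_fkInterfaceCurve D (E (δs k))
  set μs : ℕ → Measure (CurveClass ℂ) := fun k ↦ (P k).map (Y k) with hμsdef
  haveI hμsP : ∀ k, IsProbabilityMeasure (μs k) := fun k ↦
    Measure.isProbabilityMeasure_map (hYm k)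
  have hlim' : ∀ f : CurveClass ℂ →ᵇ ℝ,
      Tendsto (fun k ↦ ∫ c, f c ∂μs k) atTop (𝓝 (∫ c, f c ∂μ)) := by
    intro f
    have hint : ∀ k, ∫ c, f c ∂μs k = ∫ ω, f (Y k ω) ∂P k := fun k ↦
      integral_map (hYm k) f.continuous.aestronglyMeasurable
    simp_rw [hint]
    exact hconv f
  -- box tightness, in the form of laws
  have hbox' : ∀ ε : ℝ≥0∞, 0 < ε → ∃ (δγ δW : ℕ → ℝ) (T : ℕ → ℝ≥0), (∀ j, 0 < δγ j) ∧
      (∀ j, 0 < δW j) ∧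
      ∀ k, μs k ((fun p ↦ compactifiedClass (φs k).boundaryExtension ((Ds k).pt 1) p.1) ''
        {p : C(ℝ≥0, ℂ) × C(ℝ≥0, ℝ) | p ∈ generatedPairs ∧
          p.1 ∈ Process.modulusSet ({0} : Set ℂ) δγ ∧ p.2 ∈ Process.modulusSet ({0} : Set ℝ) δW ∧
          ∀ (j : ℕ) (t : ℝ≥0), T j ≤ t → (j : ℝ) ≤ ‖p.1 t‖})ᶜ ≤ ε := by
    intro ε hε
    obtain ⟨δγ, δW, T, hδγ, hδW, hall⟩ := hbox ε hε
    refine ⟨δγ, δW, T, hδγ, hδW, fun k ↦ ?_⟩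
    set 𝒦 : Set (C(ℝ≥0, ℂ) × C(ℝ≥0, ℝ)) := {p | p ∈ generatedPairs ∧
      p.1 ∈ Process.modulusSet ({0} : Set ℂ) δγ ∧ p.2 ∈ Process.modulusSet ({0} : Set ℝ) δW ∧
      ∀ (j : ℕ) (t : ℝ≥0), T j ≤ t → (j : ℝ) ≤ ‖p.1 t‖} with h𝒦def
    have h𝒦 : IsCompact 𝒦 := isCompact_pairBox hδγ hδW T
    have hgen : 𝒦 ⊆ generatedPairs := fun p hp ↦ hp.1
    have htrans : ∀ r : ℝ, ∃ T' : ℝ≥0, ∀ p ∈ 𝒦, ∀ t, T' ≤ t → r ≤ ‖p.1 t‖ := fun r ↦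
      ⟨T ⌈r⌉₊, fun p hp t ht ↦ (Nat.le_ceil r).trans (hp.2.2.2 _ t ht)⟩
    have hclosed : IsClosed ((fun p ↦ compactifiedClass (φs k).boundaryExtension ((Ds k).pt 1)
        p.1) '' 𝒦) :=
      (isClosed_image_and_continuousOn_drivingPath (hφs k) h𝒦 hgen htrans).2.2.1
    change ((P k).map (Y k)) _ ≤ ε
    rw [Measure.map_apply_of_aemeasurable (hYm k) hclosed.measurableSet.compl]
    exact hall k
  -- Kemppainen–Smirnov in approximating domains: describability and driving convergence
  obtain ⟨hdesc, hTD⟩ :=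
    ae_isLoewnerDescribable_and_tendstoInDistribution_drivingPath_varying hφ hφs hU1 hU2 hb
      hlim' hbox'
  -- transport of the driving-process convergence to the lattice probability spaces
  have hTD' := tendstoInDistribution_comp_of_map_eq hTD Y hYm fun k ↦ rfl
  refine ⟨hdesc, fun _ ↦ BondConfig (Site 2), fun _ ↦ Set.instMeasurableSpace, P,
    fun k ↦ inferInstance, fun k u ω ↦ drivingFunction (φs k) (Y k ω) u,
    fun k ω ↦ continuous_drivingFunction (φs k) (Y k ω), hTD', ?_⟩
  -- the discrete observable martingale data from the clocks
  intro y hy s t hst htT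
  obtain ⟨C, ε, Δ, η, hε, hΔ, hη, hk⟩ := hclock y hy s t hst htT
  exact exists_discreteMartingaleData_of_clocks_bound (P := P) hst hε hΔ hη hk

/-- **Crit-ising.S17 (FK) = CDHKS Theorem 2 from the RSW bound and the lattice data.** The
named fact `convergesInLawToSLE_sixteen_thirds_fkInterface` follows from the RSW crossing bound
`fkIsing_rsw` (Duminil-Copin–Smirnov 2012, Thm. 3.16: tightness, via
`fkInterface_traversalBound_of_fkIsing_rsw`) and the lattice data (1)–(3) of
`exists_observableMartingale_fkInterface_of_latticeData` (convergence of the discrete uniformizing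
maps, Kemppainen–Smirnov box tightness of the interfaces read through them — the output of
Condition G2, CDHKS Thm. 4 —, and the capacity clocks with Smirnov's slit-domain observable
approximation), through
`convergesInLawToSLE_sixteen_thirds_fkInterface_of_fkIsing_rsw_of_observableMartingale`. PROVED. [cite: CDHKSCRAS2014, Thm. 2 (proof: Thm. 3, Thm. 4, §3)] -/
theorem convergesInLawToSLE_sixteen_thirds_fkInterface_of_fkIsing_rsw_of_latticeData
    (hrsw : fkIsing_rsw)
    (h : ∀ (D : DobrushinDomain) (E : ℝ → DiscreteDobrushin), IsDiscretisation D E →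
      ∀ φ : ConformalEquiv upperHalfPlaneSet D.carrier, D.IsChordalUniformizing φ →
      ∀ δs : ℕ → ℝ, (∀ k, 0 < δs k) → Tendsto δs atTop (𝓝 0) →
        (∀ k, (E (δs k)).IsZdAdmissible) →
      ∃ (Ds : ℕ → DobrushinDomain) (φs : ∀ k, ConformalEquiv upperHalfPlaneSet (Ds k).carrier),
        (∀ k, (Ds k).IsChordalUniformizing (φs k)) ∧
        (∀ R : ℝ, TendstoUniformlyOn (fun k ↦ (φs k).boundaryExtension) φ.boundaryExtension
          atTop ({z : ℂ | 0 ≤ z.im} ∩ closedBall 0 R)) ∧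
        (∀ ε : ℝ, 0 < ε → ∃ r : ℝ, ∀ᶠ k in atTop, ∀ z : ℂ, z ∈ {z : ℂ | 0 ≤ z.im} → r ≤ ‖z‖ →
          dist ((φs k).boundaryExtension z) ((Ds k).pt 1) ≤ ε) ∧
        Tendsto (fun k ↦ (Ds k).pt 1) atTop (𝓝 (D.pt 1)) ∧
        (∀ ε : ℝ≥0∞, 0 < ε → ∃ (δγ δW : ℕ → ℝ) (T : ℕ → ℝ≥0), (∀ j, 0 < δγ j) ∧
          (∀ j, 0 < δW j) ∧
          ∀ k, fkDobrushinMeasure (E (δs k)) ((fkInterfaceCurve D (E (δs k))) ⁻¹'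
            ((fun p ↦ compactifiedClass (φs k).boundaryExtension ((Ds k).pt 1) p.1) ''
              {p : C(ℝ≥0, ℂ) × C(ℝ≥0, ℝ) | p ∈ generatedPairs ∧
                p.1 ∈ Process.modulusSet ({0} : Set ℂ) δγ ∧
                p.2 ∈ Process.modulusSet ({0} : Set ℝ) δW ∧
                ∀ (j : ℕ) (t : ℝ≥0), T j ≤ t → (j : ℝ) ≤ ‖p.1 t‖})ᶜ) ≤ ε) ∧
        (∀ y : ℝ, 0 < y → ∀ s t : ℝ≥0, s < t → t < cdhksTime y →
          ∃ (C : ℝ) (ε Δ η : ℕ → ℝ≥0), Tendsto ε atTop (𝓝 0) ∧ Tendsto Δ atTop (𝓝 0) ∧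
            Tendsto η atTop (𝓝 0) ∧
            ∀ k, ∃ (𝒢 : Filtration ℕ (Set.instMeasurableSpace :
                MeasurableSpace (BondConfig (Site 2))))
              (θ : ℕ → BondConfig (Site 2) → ℝ≥0) (M : ℕ) (X : BondConfig (Site 2) → ℂ) (c : ℂ)
              (bad : Set (BondConfig (Site 2))),
              Adapted 𝒢 θ ∧ (∀ ω, ω ∉ bad → θ 0 ω ≤ Δ k) ∧
              (∀ u, Measurable[𝒢 M] fun ω ↦
                drivingFunction (φs k) (fkInterfaceCurve D (E (δs k)) ω) u) ∧
              (∀ n u, Measurable[𝒢 n] ({ω | u ≤ θ n ω}.indicator fun ω ↦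
                drivingFunction (φs k) (fkInterfaceCurve D (E (δs k)) ω) u)) ∧
              (∀ᵐ ω ∂fkDobrushinMeasure (E (δs k)), ∀ n, n ≤ M →
                ‖c * (fkDobrushinMeasure (E (δs k)))[X|𝒢 n] ω‖ ≤ C) ∧
              MeasurableSet bad ∧ fkDobrushinMeasure (E (δs k)) bad ≤ η k ∧
              (∀ ω, ω ∉ bad → ∃ n ≤ M, t ≤ θ n ω) ∧
              (∀ ω, ω ∉ bad → ∀ n, n < M → θ (n + 1) ω ≤ θ n ω + Δ k) ∧
              (∀ᵐ ω ∂fkDobrushinMeasure (E (δs k)), ω ∉ bad → ∀ n, n ≤ M → θ n ω ≤ t + Δ k →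
                ‖c * (fkDobrushinMeasure (E (δs k)))[X|𝒢 n] ω -
                  observableProcess (fun u ω ↦ drivingFunction (φs k)
                    (fkInterfaceCurve D (E (δs k)) ω) u) y (θ n ω) ω‖ ≤ ε k))) :
    convergesInLawToSLE_sixteen_thirds_fkInterface :=
  convergesInLawToSLE_sixteen_thirds_fkInterface_of_fkIsing_rsw_of_observableMartingale hrsw
    (exists_observableMartingale_fkInterface_of_latticeData h)

end Literature.Probability.LatticeModels
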